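import Mathlib
import HarnessLib
import HarnessLib.Audit
import Summits.AtomisticToContinuum.Crystallization.Statement
import Summits.AtomisticToContinuum.Crystallization.Theses.BrittleRungDescent

/-!
# Crux `LJBondSpread` (stmt-AtomisticToContinuum-9207) — birth skeleton (BC3)

Route `BrittleRungDescent`, sub-problem `Crystallization`, crux rank 5 (the Lennard-Jones soft
kissing constant `K1_6` of the descent):

  `∃ a > 0` such that along every sequence of Lennard-Jones ground states the fraction of atoms `i`
  that are NOT [at distance `≥ (399/400)a` from every other atom, with every other atom either
  within `(401/400)a` or beyond `(63/50)a`, and with EXACTLY twelve other atoms within `(401/400)a`]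
  tends to `0`.

## The line (three stubs; the FLOOR / CAP / GAP cut of the soft-kissing predicate)

Write, for a scale `a`, a configuration `y = x N` and an atom `i`,
`hard(a,i) := ∀ j ≠ i, a(1 − 1/400) ≤ dist(y i, y j)` (hard core),
`cnt(a,i) := #{j ≠ i : dist(y i, y j) ≤ a(1 + 1/400)}` (tight coordination number),
`gap(a,i) := ∀ j ≠ i, dist ≤ a(1 + 1/400) ∨ (63/50)a ≤ dist` (the Hales annulus is empty).
The crux predicate is, propositionally, `hard ∧ gap ∧ cnt = 12`; its failure set is covered by

* `stub_twelveTightBonds` — FLOOR + STRAIN (`∃ a`, the load-bearing stub): a.e. atom has a hard core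
  `a(1 − 1/400)` and AT LEAST twelve other atoms within `a(1 + 1/400)` (twelve bonds in a 0.5 %-thin
  shell at ONE global scale).  Content: saturation of bulk atoms + two-sided strain control (elastic
  decay away from the `o(N)` defects, the `N^(-1/3)` Laplace strain, relaxed-hcp bond split `≈ 1e-4`
  inside the band — evidence `lj_local.py` on the item);
* `stub_softKissingCap` — CAP (`∀ a`): a.e., an atom with hard core `a(1 − 1/400)` and at least twelve
  others within `a(1 + 1/400)` has AT MOST twelve there (soft kissing number; per-site, not averaged:
  the thirteenth tight neighbour is excluded by Tammes-13 / `musinTarasov2012_tammes_thirteen` when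
  the neighbours are themselves hard-cored, and must be PRICED (second-shell pricing) when they are
  not — at `p = 6` one-shell accounting fails, `13·V(1.0455) < 12·V(1)`);
* `stub_halesGap` — GAP (`∀ a`): a.e., an atom with hard core `a(1 − 1/400)` and exactly twelve others
  within `a(1 + 1/400)` has NO other atom at distance in `(a(1 + 1/400), (63/50)a)` (soft `L12`: the
  weighted Flyspeck bound `card_mul_halesL_le_twelve_of_flyspeck_L12` leaves slack `≈ 0.23` at
  tolerance `1/400`, which clears the annulus only up to `≈ 1.20a`; the window `(1.20a, 1.26a)` is an
  energy statement — the `L12 scale mismatch` recorded on item 0750).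
* `LJBondSpread_of` — the kernel-checked composition (real proof, no `sorry`):
  `stub₁-sig → stub₂-sig → stub₃-sig → BrittleRungDescent.LJBondSpread` (the crux BY NAME): take the
  scale `a` of stub 1; pointwise `¬(hard ∧ gap ∧ cnt = 12) → ¬(hard ∧ 12 ≤ cnt) ∨ ((hard ∧ 12 ≤ cnt) ∧
  ¬ cnt ≤ 12) ∨ ((hard ∧ cnt = 12) ∧ ¬ gap)` (`cover_logic`), a three-set union bound on `Nat.card`
  (`natCard_not_le_add_three`) and a squeeze of densities (`tendsto_density_three_stage`).
* `LJBondSpread_of_stubs : BrittleRungDescent.LJBondSpread` — the crux from the three stubs (the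
  skeleton theorem; the only `sorry`s in its cone are the three `stub_*`).

Why `∀ a` in stubs 2–3 is honest: the hypothesis `hard(a,i) ∧ 12 ≤ cnt(a,i)` pins `a` two-sidedly
to the local bond scale (`b₁₂/1.0025 ≤ a ≤ b_min/0.9975`), so for a bulk Barlow atom the conclusions
hold at EVERY admissible `a` (13th neighbour at `√2·b > 1.26·1.0025·b`), and at scales where the
hypothesis set is `o(N)` the statements are vacuous; both are consequences of asymptotic Barlow
order of Lennard-Jones ground states at every `a`, and neither is implied by the crux at its own
scale only.

Disproof used: none on file for this crux (`ledger crux ls stmt-AtomisticToContinuum-9207`: no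
workfiles, 2026-08-17).  Negatives index (20 entries): the Crystallization ones — 4146 (local Hales at
1/100, deterministic 13-atom shells), 15929 (gapped twelve-shell census at 1/50), 17253 (one-multiplier
pricing), 3506 (one-grain gluing `∀ P`) — are deterministic / `∀ P` statements; no stub here is an
instance (all three are `o(N)` statements along Lennard-Jones ground-state sequences).
-/

namespace Summit.AtomisticToContinuum.Crystallization.Cruxes.LJBondSpread.Birth

open Filter

/-! ## Generic glue (proved) -/

/-- Pointwise cover behind the assembly: if the soft-kissing predicate `hard ∧ gap ∧ cnt = 12` fails
then either the floor `hard ∧ 12 ≤ cnt` fails, or it holds and the cap `cnt ≤ 12` fails, or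
`hard ∧ cnt = 12` holds and the gap fails. [folklore] -/
theorem cover_logic {ι : Type*} (ne lower uog : ι → Prop) (cnt : ℕ)
    (hG : ¬ ((∀ j, ne j → lower j ∧ uog j) ∧ cnt = 12)) :
    ¬ ((∀ j, ne j → lower j) ∧ 12 ≤ cnt) ∨
      (((∀ j, ne j → lower j) ∧ 12 ≤ cnt) ∧ ¬ cnt ≤ 12) ∨
      (((∀ j, ne j → lower j) ∧ cnt = 12) ∧ ¬ (∀ j, ne j → uog j)) := by
  by_cases hP : (∀ j, ne j → lower j) ∧ 12 ≤ cnt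
  · by_cases hQ : cnt ≤ 12
    · have hcnt : cnt = 12 := le_antisymm hQ hP.2
      by_cases hR : ∀ j, ne j → uog j
      · exact absurd ⟨fun j hj => ⟨hP.1 j hj, hR j hj⟩, hcnt⟩ hG
      · exact Or.inr (Or.inr ⟨⟨hP.1, hcnt⟩, hR⟩)
    · exact Or.inr (Or.inl ⟨hP, hQ⟩)
  · exact Or.inl hP

/-- Three-set union bound on `Nat.card` of subtypes of `Fin N`. [folklore] -/
theorem natCard_not_le_add_three {N : ℕ} (G A B C : Fin N → Prop)
    (h : ∀ i, ¬ G i → A i ∨ B i ∨ C i) :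
    Nat.card {i : Fin N // ¬ G i} ≤
      Nat.card {i : Fin N // A i} + Nat.card {i : Fin N // B i} + Nat.card {i : Fin N // C i} := by
  calc Nat.card {i : Fin N // ¬ G i} = ({i | ¬ G i} : Set (Fin N)).ncard := rfl
    _ ≤ (({i | A i} ∪ {i | B i}) ∪ {i | C i} : Set (Fin N)).ncard := by
        refine Set.ncard_le_ncard (fun i hi => ?_)
        simp only [Set.mem_setOf_eq, Set.mem_union] at hi ⊢
        rcases h i hi with hA | hB | hC
        · exact Or.inl (Or.inl hA)
        · exact Or.inl (Or.inr hB)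
        · exact Or.inr hC
    _ ≤ (({i | A i} ∪ {i | B i} : Set (Fin N))).ncard + ({i | C i} : Set (Fin N)).ncard :=
        Set.ncard_union_le _ _
    _ ≤ (({i | A i} : Set (Fin N)).ncard + ({i | B i} : Set (Fin N)).ncard) +
          ({i | C i} : Set (Fin N)).ncard := by
        gcongr
        exact Set.ncard_union_le _ _
    _ = Nat.card {i : Fin N // A i} + Nat.card {i : Fin N // B i} + Nat.card {i : Fin N // C i} :=
        rfl

/-- Three-stage density bound: if the densities of the three covering sets tend to `0`, so does the
density of the covered failure set. [folklore] -/
theorem tendsto_density_three_stage (G A B C : (N : ℕ) → Fin N → Prop)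
    (hA : Tendsto (fun N : ℕ => (Nat.card {i : Fin N // A N i} : ℝ) / N) atTop (nhds 0))
    (hB : Tendsto (fun N : ℕ => (Nat.card {i : Fin N // B N i} : ℝ) / N) atTop (nhds 0))
    (hC : Tendsto (fun N : ℕ => (Nat.card {i : Fin N // C N i} : ℝ) / N) atTop (nhds 0))
    (h : ∀ N i, ¬ G N i → A N i ∨ B N i ∨ C N i) :
    Tendsto (fun N : ℕ => (Nat.card {i : Fin N // ¬ G N i} : ℝ) / N) atTop (nhds 0) := by
  have hsum : Tendsto (fun N : ℕ => (Nat.card {i : Fin N // A N i} : ℝ) / N +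
      (Nat.card {i : Fin N // B N i} : ℝ) / N + (Nat.card {i : Fin N // C N i} : ℝ) / N)
      atTop (nhds 0) := by
    simpa only [add_zero] using (hA.add hB).add hC
  refine squeeze_zero (fun N => by positivity) (fun N => ?_) hsum
  rw [← add_div, ← add_div]
  gcongr
  exact_mod_cast natCard_not_le_add_three (G N) (A N) (B N) (C N) (h N)

/-! ## The stubs -/

/-- **Stub 1 — FLOOR + STRAIN (twelve tight bonds at one global scale; load-bearing).**  There is a
scale `a > 0` such that along every sequence of Lennard-Jones ground states the fraction of atoms `i`
failing [every other atom at distance `≥ a(1 − 1/400)` ∧ at least twelve other atoms within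
`a(1 + 1/400)`] tends to `0`.  Why plausibly true: bulk Lennard-Jones ground states are expected to
be relaxed hcp with nearest-neighbour split `≈ 1e-4` (evidence `lj_local.py` on the item, 70×
inside the band), elastic strain decaying away from `o(N)` defects and the `N^(-1/3)` Laplace strain
vanishing; fails iff a positive fraction of bulk atoms is strained `> 0.25 %` or under-coordinated
(persistent five-fold / Frank–Kasper order).  Strictly weaker than the crux (no cap, no gap); the
0.25 %-tolerance, free-scale analogue of `SquareWellLayerCake.TwelveWithinOne` (item 15808, hard core
`55/57`, radius `1`).  Size: XL (open: BlancLewin2015 §2.3).  Leans on: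
`LennardJonesGroundStatesExist_holds`, `LennardJonesMinimalDistance_holds`, `crysEnergyUpper_proof`
(trial upper bound), second-shell pricing (card link-census-gauss-bonnet-3d). -/
theorem stub_twelveTightBonds : ∃ a : ℝ, 0 < a ∧ ∀ x : (N : ℕ) → (Fin N → EuclideanSpace ℝ (Fin 3)), (∀ N, Literature.MathematicalPhysics.StatisticalMechanics.IsGroundState Literature.MathematicalPhysics.StatisticalMechanics.lennardJones (x N)) → Filter.Tendsto (fun N : ℕ => (Nat.card {i : Fin N // ¬ ((∀ j : Fin N, j ≠ i → a * (1 - 1 / 400) ≤ dist (x N i) (x N j)) ∧ 12 ≤ Nat.card {j : Fin N // j ≠ i ∧ dist (x N i) (x N j) ≤ a * (1 + 1 / 400)})} : ℝ) / N) Filter.atTop (nhds 0) := by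
  sorry

/-- **Stub 2 — CAP (soft kissing number, per site, every scale).**  For every `a > 0`, along every
sequence of Lennard-Jones ground states the fraction of atoms `i` that HAVE a hard core `a(1 − 1/400)`
and at least twelve other atoms within `a(1 + 1/400)` but MORE than twelve there tends to `0`.  Why
plausibly true: the hypothesis pins `a` to the local bond scale within 0.25 %; thirteen points at
distances in `[0.9975a, 1.0025a]` from `x_i` that are pairwise `≥ 0.9975a` apart contradict Tammes-13
(`a₁₃ = 57.14° < 60°`, `musinTarasov2012_tammes_thirteen`; even the `L12` weighted bound suffices at
this tolerance), so only atoms with a NON-hard-cored tight neighbour remain, and those must be priced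
by the energy (second-shell pricing: at `p = 6` a stretched 13-shell beats 12 exact contacts at first
shell, `13·V(1.0455) < 12·V(1)`); fails iff 13-coordinated stretched motifs persist at positive
density at some scale.  Not implied by the crux (which speaks of one scale only).  Size: L.  Leans on:
`musinTarasov2012_tammes_thirteen` / `flyspeck_L12` (named facts, to be used only once PROVED or as
certified numerics), `LennardJonesMinimalDistance_holds`, `AveragedTwelve`-type averaging (item 15806)
as an alternative engine. -/
theorem stub_softKissingCap : ∀ a : ℝ, 0 < a → ∀ x : (N : ℕ) → (Fin N → EuclideanSpace ℝ (Fin 3)), (∀ N, Literature.MathematicalPhysics.StatisticalMechanics.IsGroundState Literature.MathematicalPhysics.StatisticalMechanics.lennardJones (x N)) → Filter.Tendsto (fun N : ℕ => (Nat.card {i : Fin N // ((∀ j : Fin N, j ≠ i → a * (1 - 1 / 400) ≤ dist (x N i) (x N j)) ∧ 12 ≤ Nat.card {j : Fin N // j ≠ i ∧ dist (x N i) (x N j) ≤ a * (1 + 1 / 400)}) ∧ ¬ (Nat.card {j : Fin N // j ≠ i ∧ dist (x N i) (x N j) ≤ a * (1 + 1 / 400)} ≤ 12)} : ℝ) / N)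 Filter.atTop (nhds 0) := by
  sorry

/-- **Stub 3 — GAP (soft `L12`, every scale).**  For every `a > 0`, along every sequence of
Lennard-Jones ground states the fraction of atoms `i` that HAVE a hard core `a(1 − 1/400)` and exactly
twelve other atoms within `a(1 + 1/400)` but ALSO some other atom at distance strictly between
`a(1 + 1/400)` and `(63/50)a` tends to `0`.  Why plausibly true: for a bulk Barlow atom the thirteenth
neighbour sits at `√2·b ≥ 1.41·0.9975a > 1.26a`; quantitatively, with twelve hard-cored neighbours at
half-distance `h ≤ 1.005` the weighted Flyspeck bound `Σ L(‖v‖/2) ≤ 12`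
(`card_mul_halesL_le_twelve_of_flyspeck_L12`, `L(h) = (1.26 − h)/0.26`) leaves slack `12·(0.005/0.26)
≈ 0.23`, which forbids a thirteenth centre below `≈ 1.20a`; the window `(1.20a, 1.26a)` (and atoms
whose neighbours lack the hard core) is an ENERGY statement — an atom parked at `1.2–1.26` bond
lengths from a saturated twelve-shell is a second-shell defect to be priced (the "L12 scale mismatch"
recorded on item 0750).  Fails iff such interstitial-type motifs persist at positive density.  Size:
M–L.  Leans on: `flyspeck_L12` (named fact; or certified numerics), `hales_h0`, `halesL`,
`LennardJonesMinimalDistance_holds`. -/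
theorem stub_halesGap : ∀ a : ℝ, 0 < a → ∀ x : (N : ℕ) → (Fin N → EuclideanSpace ℝ (Fin 3)), (∀ N, Literature.MathematicalPhysics.StatisticalMechanics.IsGroundState Literature.MathematicalPhysics.StatisticalMechanics.lennardJones (x N)) → Filter.Tendsto (fun N : ℕ => (Nat.card {i : Fin N // ((∀ j : Fin N, j ≠ i → a * (1 - 1 / 400) ≤ dist (x N i) (x N j)) ∧ Nat.card {j : Fin N // j ≠ i ∧ dist (x N i) (x N j) ≤ a * (1 + 1 / 400)} = 12) ∧ ¬ (∀ j : Fin N, j ≠ i → (dist (x N i) (x N j) ≤ a * (1 + 1 / 400) ∨ 63 / 50 * a ≤ dist (x N i) (x N j)))} : ℝ) / N) Filter.atTop (nhds 0) := by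
  sorry

/-! ## The composition (kernel-checked, no sorry) -/

/-- **Composition** `stub₁-signature → stub₂-signature → stub₃-signature → LJBondSpread` (the crux
BY NAME), real proof: take the scale `a` of stub 1; for a ground-state sequence `x` the failure set of
the crux predicate at `N` is covered (`cover_logic`) by the failure set of the floor, the floor-holds-
but-cap-fails set and the twelve-but-gap-fails set; `natCard_not_le_add_three` +
`tendsto_density_three_stage`. [folklore] -/
theorem LJBondSpread_of :
    (∃ a : ℝ, 0 < a ∧ ∀ x : (N : ℕ) → (Fin N → EuclideanSpace ℝ (Fin 3)), (∀ N, Literature.MathematicalPhysics.StatisticalMechanics.IsGroundState Literature.MathematicalPhysics.StatisticalMechanics.lennardJones (x N)) → Filter.Tendsto (fun N : ℕ => (Nat.card {i : Fin N // ¬ ((∀ j : Fin N, j ≠ i → a * (1 - 1 / 400) ≤ dist (x N i) (x N j)) ∧ 12 ≤ Nat.card {j : Fin N // j ≠ i ∧ dist (x N i) (x N j) ≤ a * (1 + 1 / 400)})} : ℝ) / N) Filter.atTop (nhds 0)) →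
    (∀ a : ℝ, 0 < a → ∀ x : (N : ℕ) → (Fin N → EuclideanSpace ℝ (Fin 3)), (∀ N, Literature.MathematicalPhysics.StatisticalMechanics.IsGroundState Literature.MathematicalPhysics.StatisticalMechanics.lennardJones (x N)) → Filter.Tendsto (fun N : ℕ => (Nat.card {i : Fin N // ((∀ j : Fin N, j ≠ i → a * (1 - 1 / 400) ≤ dist (x N i) (x N j)) ∧ 12 ≤ Nat.card {j : Fin N // j ≠ i ∧ dist (x N i) (x N j) ≤ a * (1 + 1 / 400)}) ∧ ¬ (Nat.card {j : Fin N // j ≠ i ∧ dist (x N i) (x N j) ≤ a * (1 + 1 / 400)} ≤ 12)} : ℝ) / N) Filter.atTop (nhds 0)) →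
    (∀ a : ℝ, 0 < a → ∀ x : (N : ℕ) → (Fin N → EuclideanSpace ℝ (Fin 3)), (∀ N, Literature.MathematicalPhysics.StatisticalMechanics.IsGroundState Literature.MathematicalPhysics.StatisticalMechanics.lennardJones (x N)) → Filter.Tendsto (fun N : ℕ => (Nat.card {i : Fin N // ((∀ j : Fin N, j ≠ i → a * (1 - 1 / 400) ≤ dist (x N i) (x N j)) ∧ Nat.card {j : Fin N // j ≠ i ∧ dist (x N i) (x N j) ≤ a * (1 + 1 / 400)} = 12) ∧ ¬ (∀ j : Fin N, j ≠ i → (dist (x N i) (x N j) ≤ a * (1 + 1 / 400) ∨ 63 / 50 * a ≤ dist (x N i) (x N j)))} : ℝ) / N) Filter.atTop (nhds 0)) →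
    Summit.AtomisticToContinuum.Crystallization.Theses.BrittleRungDescent.LJBondSpread := by
  intro h₁ h₂ h₃
  obtain ⟨a, ha, h₁a⟩ := h₁
  refine ⟨a, ha, fun x hx => ?_⟩
  exact tendsto_density_three_stage _ _ _ _ (h₁a x hx) (h₂ a ha x hx) (h₃ a ha x hx)
    (fun N i hG => cover_logic _ _ _ _ hG)

/-- **The crux BY NAME from the three stubs** (type literally the route decl; the only `sorry`s in
its cone are `stub_twelveTightBonds`, `stub_softKissingCap`, `stub_halesGap`). -/
theorem LJBondSpread_of_stubs :
    Summit.AtomisticToContinuum.Crystallization.Theses.BrittleRungDescent.LJBondSpread :=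
  LJBondSpread_of stub_twelveTightBonds stub_softKissingCap stub_halesGap

end Summit.AtomisticToContinuum.Crystallization.Cruxes.LJBondSpread.Birth
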